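import Literature.MathematicalPhysics.QuantumFieldTheory.Balaban1983to89.B4NextAvg52
import Literature.MathematicalPhysics.QuantumFieldTheory.Balaban1983to89.B4Prop31Regular
import Literature.MathematicalPhysics.QuantumFieldTheory.Balaban1983to89.B4Prop23Sect5Route

/-!
# `Balaban1983to89.B4Ineq53RegularRegion` — T. Bałaban, *Regularity and decay of lattice Green's functions*, Commun.
# Math. Phys. **89** (1983) 571–597 [Balaban1983RegularityDecay] (= B4), p. 593 (5.1)–(5.3): the two-sided form
# bound (1.15) `γ₀I ≤ Δ^{(k)}(Ω,A) + aL^{−2}P(A) ≤ γ₁I` PROVED AT A REGULAR `A ≠ 0` on every finite union of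
# `L`-blocks, by the printed route «(5.1) elementary; (5.2) = Proposition II.3.1′; (5.3) = Neumann decoupling of the
# `L`-blocks + gauging + Laplacian-plus-projection bound»

statement-level skeleton of published theorems with citation tags; proofs where landed; nothing here is a claim about the Yang–Mills mass gap

PDF held: `paper:balaban1983-cmp89-regularity-decay` (journal page = PDF page + 570); pp. 573–574, 593 [PDF 3–4, 23]
read on the ×2 renders `…/b2b-balaban-ref1/pages/1983-cmp89-regularity-decay/…-p003/p004/p023-x2.png`.

CITATION HEADER (lean-in-tree rule).  Cell `lit-balaban` (HOME `run/shared/lean/pub/lit-balaban/`), Phase-2 proof seat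
**p17** gen 3 (unit `lit-balaban-p17-g3`), file 2/3 of the MODEL INSTANCE of SKELETON row **B4.Prop2.3[I]**
(`B4.Prop23Printed`, owner r01, referee ref-4) AT A REGULAR `A ≠ 0`: clause (1.15).  USED BY NAME, never restated:
p35's (1.22) in lattice units `B4Prop31Regular.form122_lattice` (= (5.2) without the `P(A)` term), b04's (1.8) for
regular fields `B4Lower18RegularRegion.lower18_regular_region_stair` and `B4Lemma21Region.regionOp_form_ge`, r01's
(5.1) `B4Ineq115Sect3Route.form115_upper`, p17 gen 2's dictionary `B4Cor23Rep36Bridge.{hamR, QkR, kForm_eq_regionOp,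
deltaK_rep36_eq, hamR_isSymm}`, and file 1/3 `B4NextAvg52` (`uField`, `nextAvg` = `Q(A)`, `P(A) = pOp L^{d+1} Q(A)`,
`covLap_unit_form`, `pOp_nextAvg_form`, `rowOrtho_nextAvg`).

WHAT IS PRINTED (p. 574 [PDF 4] (1.15); p. 593 [PDF 23]): *"γ₀I ≤ Δ^{(k)}(Ω,A) + aL^{−2}P(A) ≤ γ₁I, (1.15)"*; *"The
upper bound is quite elementary because Δ^{(k)}(Ω,A) + aL^{−2}P(A) = a_kI − a_k²Q_k(A)G_k(Ω,A)Q_k^*(A) + aL^{−2}P(A) ≤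
a_kI + aL^{−2}Q^*(A)Q(A) ≤ (a_k + aL^{−2})I = a(a_k/a_{k+1})I. (5.1) … To prove the lower bound we apply Proposition
II.3.1′ to Δ^{(k)}(Ω,A): [(5.2)] … we separate the blocks by Neumann boundary conditions … we "gauge away" the constant
field, and we obtain the Laplace operator with Neumann boundary conditions for each block plus the projection operator on
constant functions. This sum is bounded from below by a positive constant (more precisely by ½γ₀min{π²L^{−2}, aL^{−2}}),
thus we have ⟨φ,(Δ^{(k)}(Ω,A) + aL^{−2}P(A))φ⟩ ≥ γ₀′⟨φ,φ⟩ − O(e^{2−δ})⟨φ,φ⟩ ≥ γ₀″⟨φ,φ⟩. (5.3) for e sufficiently small"*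
DICTIONARY (as `B4NextAvg52`/`B4Cor23Rep36Bridge`; lattice units, `d ↦ d+1`, `κ = e/n`): `Ω^{(k)} = fineDom L Zc` (finite
union of `L`-blocks of unit sites, `Zc = Ω^{(k+1)}`), `Ω = fineDom n (fineDom L Zc)`; `Δ^{(k)}(Ω,A)` = r01's `deltaK (hamR …)
a_k (QkR …)` on b04's regular-field carriers; `aL^{−2}P(A)` = `(a′·L^{−2})•pOp L^{d+1} (nextAvg …)`; (1.7) ↦ `|A_ν(x+e_μ) −
A_ν(x)| ≤ c·e^{β−1}/n` on `Ω`; «e sufficiently small» ↦ the binders `hsmall` (b04's, fine lattice), `hsmallU` (the same at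
the unit lattice, mesh `L`), `hX` (the `O(e^{2−δ})` remainder of (5.2) is at most the gain `γ₀″`).

WHAT IS KERNEL-CHECKED (zero `sorry`, standard axioms; no `Prop`-valued definition): §1 `fineDom_nest`, `nBase`,
`abs_uField_sub_nBase_le`, `unit_blockwise` (under (1.7) on `Ω` the unit-lattice field `A(⟨x,x+e_μ⟩)` differs inside each
`L`-block from the block constant `n·A_ν(corner)` by `≤ (d+1)n²Lδ` — b04's «A = A₀ + A′ per block» hypothesis on the unit
lattice); §1 **`block_lower_regular`** — THE p. 593 SENTENCE (5.2) ⇒ (5.3) AT `A ≠ 0`: `(min(2,a″)/4)·|φ|² ≤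
L²·Σ_{⟨x,x′⟩⊂Ω^{(k)}}|U(A(⟨x,x′⟩))φ(x′) − φ(x)|² + a″⟨φ,P(A)φ⟩` for every `a″ ≥ 0`, by APPLYING b04's (1.8) for regular
fields (`lower18_regular_region_stair`: Neumann decoupling of the blocks, `A = A₀ + A′`, gauging away `A₀`, Laplacian +
projection `≥ min(2,a)/4`) to the unit lattice as the region of mesh `L` over `Ω^{(k+1)}` with the field `uField n A`
(RECORDED DEVIATION: printed constant `½γ₀min{π²,a}L^{−2}` ↦ `min(2,a″)/(4L²)`); §2 **`form115_upper_regular`** —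
(5.1) = (1.15) upper `≤ (a_k + a′L^{−2})|φ|²` (r01's `form115_upper`, `G_k(Ω,A) > 0` by b04 `regionOp_form_ge`); §3
**`form115_lower_regular`** — (5.2)–(5.3) = (1.15) lower with the EXPLICIT `γ₀″ = gamLow =
γ₀(a,m²₊)·min(2,a′/γ₀(a,m²₊))/(8L²)`, `γ₀(a,m²) = 1/max((6(d+1)+2m²)/a, 24)` (p35's (1.22) constant), uniformly for `m² ∈
[0, m²₊]`.  HONEST LABELS: all constants are the lineage's; `γ₀″` depends on `(d, L, a_k, a′, m²₊)` (print: «dependent on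
d and M only», silent `L`-dependence = census D-b04.4).  Unit `lit-balaban-p17-g3`, HOME as above.
DOCFIX 2026-08-22 (lit-balaban-p17 gen 26, on r04 g22 `CITELOC-AUDIT-g22.md` §3, verified on the text layer of [Balaban1983RegularityDecay]): citation locators only — «p. 573 (1.7)» → «p. 572 (1.7)» at two `[cite:]` tags; every declaration byte-identical.
-/

namespace Literature.MathematicalPhysics.QuantumFieldTheory.Balaban1983to89.B4Ineq53RegularRegion

open Finset Matrix
open Literature.MathematicalPhysics.QuantumFieldTheory.Balaban1983to89
open Literature.MathematicalPhysics.QuantumFieldTheory.Balaban1983to89.B4GaugeCovariance (OrthFlow avgOp covOp projOp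
  projOp_form)
open Literature.MathematicalPhysics.QuantumFieldTheory.Balaban1983to89.B4Lower18Regular (dotProduct_self_nonneg' e1
  covOp_form)
open Literature.MathematicalPhysics.QuantumFieldTheory.Balaban1983to89.B4Lower18RegularRegion (regWt rBlkWt compField
  compField_add compField_sub blockConst constBond_step constBond_step_rev abs_comp_sub_base_le
  lower18_regular_region_stair)
open Literature.MathematicalPhysics.QuantumFieldTheory.Balaban1983to89.B4Reflection242 (nbrs blk mem_nbrs)
open Literature.MathematicalPhysics.QuantumFieldTheory.Balaban1983to89.B4Lower18 (fineDom mem_fineDom)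
open Literature.MathematicalPhysics.QuantumFieldTheory.Balaban1983to89.B4Prop31Holonomy (base segSum_eq_sum
  blk_base_add_nsmul)
open Literature.MathematicalPhysics.QuantumFieldTheory.Balaban1983to89.B4Prop31Charts (linkR transR covDiffSq)
open Literature.MathematicalPhysics.QuantumFieldTheory.Balaban1983to89.B4Prop31Regular (form122_lattice)
open Literature.MathematicalPhysics.QuantumFieldTheory.Balaban1983to89.B4Lemma21Region (regionOp regionOp_form_ge)
open Literature.MathematicalPhysics.QuantumFieldTheory.Balaban1983to89.B4GaussRep36 (kForm pOp)
open Literature.MathematicalPhysics.QuantumFieldTheory.Balaban1983to89.B4Sect3BlockAveraging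
  (dotProduct_pOp_mulVec_nonneg dotProduct_pOp_mulVec_le)
open Literature.MathematicalPhysics.QuantumFieldTheory.Balaban1983to89.B4Cor23Rep36Bridge (hamR QkR kForm_eq_regionOp
  deltaK_rep36_eq hamR_isSymm)
open Literature.MathematicalPhysics.QuantumFieldTheory.Balaban1983to89.B4NextAvg52 (uField uField_apply nextAvg
  pOp_nextAvg_form covLap_unit_form rowOrtho_nextAvg)

noncomputable section

variable {d : ℕ} {ι : Type} [Fintype ι] [DecidableEq ι]

/-! ## §1. Regularity of the unit-lattice field from (1.7), and the block step (5.2) ⇒ (5.3) at `A ≠ 0` -/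

/-- iterated block labels. [folklore] -/
private theorem blk_blk' (a b : ℕ) (x : Fin (d + 1) → ℤ) : blk a (blk b x) = blk (b * a) x := by
  funext i
  simp only [blk]
  push_cast
  exact Int.ediv_ediv_of_nonneg (Int.natCast_nonneg b)

/-- the fine region over a union of `L`-blocks of unit sites is the fine region of mesh `nL` over the `L`-block labels.
[cite: Balaban1983RegularityDecay, p. 572 (1.1)] -/
theorem fineDom_nest {n L : ℕ} (hn : 1 ≤ n) (hL : 1 ≤ L) (Zc : Finset (Fin (d + 1) → ℤ)) :
    fineDom n (fineDom L Zc) = fineDom (n * L) Zc := by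
  ext x
  rw [mem_fineDom hn, mem_fineDom hL, mem_fineDom (Nat.one_le_iff_ne_zero.2 (Nat.mul_ne_zero
    (Nat.one_le_iff_ne_zero.1 hn) (Nat.one_le_iff_ne_zero.1 hL))), blk_blk']

/-- the `L`-block comparison field `A₀(Δ) = n·A(base corner of the nL-block)` (b04's `A = A₀ + A′` per block).
[cite: Balaban1983RegularityDecay, p. 593 «in each block we decompose A = A₀ + A′»] -/
def nBase (n L : ℕ) (Ac : (Fin (d + 1) → ℤ) → Fin (d + 1) → ℝ) : (Fin (d + 1) → ℤ) → Fin (d + 1) → ℝ :=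
  fun z μ => (n : ℝ) * Ac (base (n * L) z) μ

/-- **THE UNIT-LATTICE FIELD IS `A₀ + (small)` ON EVERY `L`-BLOCK**: under `|A_ν(x+e_μ) − A_ν(x)| ≤ δ` on `Ω`, for every
unit site `x` of the `L`-block `Δ`, `|A(⟨x,x+e_ν⟩) − n·A_ν(base corner of Δ)| ≤ n·(d+1)(nL)δ` (each of the `n` fine links
of the unit bond is joined to the corner by a fine staircase inside `Δ`: b04's `abs_comp_sub_base_le` at mesh `nL`).
[cite: Balaban1983RegularityDecay, p. 593 «in each block we decompose A = A₀ + A′», p. 572 (1.7)] -/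
theorem abs_uField_sub_nBase_le {n L : ℕ} (hn : 1 ≤ n) (hL : 1 ≤ L) (Zc : Finset (Fin (d + 1) → ℤ))
    {Ac : (Fin (d + 1) → ℤ) → Fin (d + 1) → ℝ} {δ : ℝ} (hδ : 0 ≤ δ)
    (h17 : ∀ x ∈ fineDom n (fineDom L Zc), ∀ μ ν : Fin (d + 1), |Ac (x + e1 μ) ν - Ac x ν| ≤ δ)
    (x : ↥(fineDom L Zc)) (ν : Fin (d + 1)) :
    |uField n Ac x.1 ν - nBase n L Ac (blk L x.1) ν| ≤ n * ((d + 1) * (n * L) * δ) := by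
  have hnL : 1 ≤ n * L := Nat.one_le_iff_ne_zero.2 (Nat.mul_ne_zero (Nat.one_le_iff_ne_zero.1 hn)
    (Nat.one_le_iff_ne_zero.1 hL))
  have h17' : ∀ z ∈ fineDom (n * L) Zc, ∀ μ ν : Fin (d + 1), |Ac (z + e1 μ) ν - Ac z ν| ≤ δ :=
    fun z hz => h17 z (by rwa [fineDom_nest hn hL])
  have hterm : ∀ t ∈ range n,
      |Ac (base n x.1 + t • e1 ν) ν - Ac (base (n * L) (blk L x.1)) ν| ≤ (d + 1) * (n * L) * δ := by
    intro t ht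
    have ht' : t < n := mem_range.1 ht
    have hblk : blk (n * L) (base n x.1 + t • e1 ν) = blk L x.1 := by
      rw [← blk_blk', blk_base_add_nsmul hn x.1 ν ht']
    have hmem : base n x.1 + t • e1 ν ∈ fineDom (n * L) Zc := by
      rw [mem_fineDom hnL, hblk]
      exact (mem_fineDom hL).1 x.2
    have h := abs_comp_sub_base_le hnL Zc hδ h17' hmem ν
    rw [hblk] at h
    have hb : (fun j => ((n * L : ℕ) : ℤ) * blk L x.1 j) = base (n * L) (blk L x.1) := rfl
    rw [hb] at h
    push_cast at h
    exact h
  rw [uField_apply, segSum_eq_sum, nBase]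
  calc |∑ t ∈ range n, Ac (base n x.1 + t • e1 ν) ν - n * Ac (base (n * L) (blk L x.1)) ν|
      = |∑ t ∈ range n, (Ac (base n x.1 + t • e1 ν) ν - Ac (base (n * L) (blk L x.1)) ν)| := by
        rw [Finset.sum_sub_distrib, Finset.sum_const, Finset.card_range, nsmul_eq_mul]
    _ ≤ ∑ t ∈ range n, |Ac (base n x.1 + t • e1 ν) ν - Ac (base (n * L) (blk L x.1)) ν| :=
        Finset.abs_sum_le_sum_abs _ _
    _ ≤ ∑ _t ∈ range n, (d + 1) * (n * L) * δ := Finset.sum_le_sum hterm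
    _ = n * ((d + 1) * (n * L) * δ) := by rw [Finset.sum_const, Finset.card_range, nsmul_eq_mul]

/-- **THE HYPOTHESIS `hA` OF b04's (1.8) ON THE UNIT LATTICE**: on every intra-`L`-block nearest-neighbour pair the
unit-lattice field differs from the block-constant comparison field by `≤ |κ|(d+1)n²L²δ/L` after multiplication by
`κ`. [cite: Balaban1983RegularityDecay, p. 593 «A = A₀ + A′ … small field A′», p. 572 (1.7)] -/
theorem unit_blockwise {n L : ℕ} (hn : 1 ≤ n) (hL : 1 ≤ L) (Zc : Finset (Fin (d + 1) → ℤ))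
    {Ac : (Fin (d + 1) → ℤ) → Fin (d + 1) → ℝ} {δ : ℝ} (hδ : 0 ≤ δ)
    (h17 : ∀ x ∈ fineDom n (fineDom L Zc), ∀ μ ν : Fin (d + 1), |Ac (x + e1 μ) ν - Ac x ν| ≤ δ) (κ : ℝ)
    (u v : ↥(fineDom L Zc)) (hnb : v.1 ∈ nbrs u.1) (hblk : blk L v.1 = blk L u.1) :
    |κ * (compField (uField n Ac) u.1 v.1 - blockConst L (fineDom L Zc) (nBase n L Ac) u v)|
      ≤ |κ| * ((d + 1) * n ^ 2 * L ^ 2 * δ) / L := by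
  have hL0 : (0 : ℝ) < L := by exact_mod_cast hL
  have key : |compField (uField n Ac) u.1 v.1 - blockConst L (fineDom L Zc) (nBase n L Ac) u v|
      ≤ n * ((d + 1) * (n * L) * δ) := by
    obtain ⟨i, h | h⟩ := mem_nbrs.1 hnb
    · have h' : v.1 = u.1 + e1 i := h
      have hc : compField (uField n Ac) u.1 v.1 = uField n Ac u.1 i := by rw [h']; exact compField_add _ _ _
      have hk : blockConst L (fineDom L Zc) (nBase n L Ac) u v = nBase n L Ac (blk L u.1) i := constBond_step _ h'
      rw [hc, hk]
      exact abs_uField_sub_nBase_le hn hL Zc hδ h17 u i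
    · have h' : u.1 = v.1 + e1 i := by rw [h]; simp [e1]
      have hc : compField (uField n Ac) u.1 v.1 = -uField n Ac v.1 i := by rw [h']; exact compField_sub _ _ _
      have hk : blockConst L (fineDom L Zc) (nBase n L Ac) u v = -nBase n L Ac (blk L u.1) i :=
        constBond_step_rev _ h'
      rw [hc, hk, ← hblk, show -uField n Ac v.1 i - -nBase n L Ac (blk L v.1) i
        = -(uField n Ac v.1 i - nBase n L Ac (blk L v.1) i) by ring, abs_neg]
      exact abs_uField_sub_nBase_le hn hL Zc hδ h17 v i
  rw [abs_mul]
  calc |κ| * |compField (uField n Ac) u.1 v.1 - blockConst L (fineDom L Zc) (nBase n L Ac) u v|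
      ≤ |κ| * (n * ((d + 1) * (n * L) * δ)) := mul_le_mul_of_nonneg_left key (abs_nonneg κ)
    _ = |κ| * ((d + 1) * n ^ 2 * L ^ 2 * δ) / L := by
        rw [eq_div_iff hL0.ne']
        ring

/-- **p. 593, (5.2) ⇒ (5.3), AT A REGULAR `A ≠ 0`**: *"we separate the blocks by Neumann boundary conditions, in each block
we decompose A = A₀ + A′ into a constant field A₀ and small field A′ … we "gauge away" the constant field, and we obtain
the Laplace operator with Neumann boundary conditions for each block plus the projection operator on constant functions.
This sum is bounded from below by a positive constant"* — for EVERY `a″ ≥ 0`, every mesh `n ≥ 1`, every `L ≥ 1`, every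
finite `Ω^{(k+1)} = Zc`, every vector field with `|A_ν(x+e_μ) − A_ν(x)| ≤ δ` on `Ω` and the smallness
`ℓ²(|κ|(d+1)n²L²δ)²(d+1)(1+a″(d+1)) ≤ min(2,a″)/4`, and every `φ : Ω^{(k)} → R^N`:
`(min(2,a″)/4)·|φ|² ≤ L²·Σ_{⟨x,x′⟩⊂Ω^{(k)}}|U(A(⟨x,x′⟩))φ(x′) − φ(x)|² + a″⟨φ,P(A)φ⟩` — b04's (1.8) for regular fields
(`lower18_regular_region_stair`) APPLIED TO THE UNIT LATTICE as the region of mesh parameter `L` over `Ω^{(k+1)}` with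
the field `uField n A`; printed constant `½γ₀min{π²,a}L^{−2}` ↦ `min(2,a″)/(4L²)` (recorded deviation).
[cite: Balaban1983RegularityDecay, p. 593 (5.2)–(5.3)] -/
theorem block_lower_regular (F : OrthFlow ι) {ℓ : ℝ} (hℓ : 0 ≤ ℓ)
    (hLip : ∀ t (v : ι → ℝ), ((F.U t - 1) *ᵥ v) ⬝ᵥ ((F.U t - 1) *ᵥ v) ≤ (ℓ * t) ^ 2 * (v ⬝ᵥ v))
    (κ : ℝ) {n L : ℕ} (hn : 1 ≤ n) (hL : 1 ≤ L) (Zc : Finset (Fin (d + 1) → ℤ))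
    (Ac : (Fin (d + 1) → ℤ) → Fin (d + 1) → ℝ) {a'' : ℝ} (ha : 0 ≤ a'') {δ : ℝ} (hδ : 0 ≤ δ)
    (h17 : ∀ x ∈ fineDom n (fineDom L Zc), ∀ μ ν : Fin (d + 1), |Ac (x + e1 μ) ν - Ac x ν| ≤ δ)
    (hsmall : ℓ ^ 2 * (|κ| * ((d + 1) * n ^ 2 * L ^ 2 * δ)) ^ 2 * (d + 1) * (1 + a'' * (d + 1)) ≤ min 2 a'' / 4)
    (ψ : ↥(fineDom L Zc) × ι → ℝ) :
    min 2 a'' / 4 * (ψ ⬝ᵥ ψ)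
      ≤ (L : ℝ) ^ 2 * covDiffSq F κ Ac n (fineDom L Zc) ψ
        + a'' * (ψ ⬝ᵥ (pOp (((L ^ (d + 1) : ℕ) : ℝ)) (nextAvg F κ hL Zc n Ac) *ᵥ ψ)) := by
  have hL0 : (0 : ℝ) < L := by exact_mod_cast hL
  have hθ : 0 ≤ |κ| * ((d + 1) * n ^ 2 * L ^ 2 * δ) := by positivity
  have h := lower18_regular_region_stair F hℓ hLip κ hL ha 0 Zc (nBase n L Ac) hθ
    (fun u v hnb hblk => unit_blockwise hn hL Zc hδ h17 κ u v hnb hblk) hsmall ψ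
  have h' : min 2 a'' / 4 * (ψ ⬝ᵥ ψ) ≤ ψ ⬝ᵥ (covOp (regWt L (fineDom L Zc)) 0 (a'' * ((L : ℝ) ^ (d + 1))⁻¹)
      (rBlkWt L Zc (fineDom L Zc)) (linkR F κ L Zc (uField n Ac)) (transR F κ hL Zc (uField n Ac)) *ᵥ ψ) := by
    rw [add_zero] at h
    exact h
  rw [covOp_form, zero_mul, add_zero, covLap_unit_form, projOp_form] at h'
  rw [pOp_nextAvg_form]
  push_cast
  linarith [h']


/-! ## §2. (5.1): the upper bound of (1.15) at a regular `A ≠ 0` -/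

/-- positive definiteness from a form bound. [folklore] -/
private theorem posDef_of_form_ge {m : Type*} [Fintype m] [DecidableEq m] {M : Matrix m m ℝ} (hM : M.IsSymm)
    {γ : ℝ} (hγ : 0 < γ) (h : ∀ v : m → ℝ, γ * (v ⬝ᵥ v) ≤ v ⬝ᵥ (M *ᵥ v)) : M.PosDef := by
  refine Matrix.PosDef.of_dotProduct_mulVec_pos (Matrix.isHermitian_iff_isSymm.2 hM) fun x hx => ?_
  rw [star_trivial]
  have hxx : 0 < x ⬝ᵥ x := by
    rcases (dotProduct_self_nonneg' x).lt_or_eq with hlt | heq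
    · exact hlt
    · exact absurd (dotProduct_self_eq_zero.1 heq.symm) hx
  exact lt_of_lt_of_le (mul_pos hγ hxx) (h x)

section Regular

variable (F : OrthFlow ι) {ℓ : ℝ} (hℓ : 0 ≤ ℓ)
  (hLip : ∀ t (v : ι → ℝ), ((F.U t - 1) *ᵥ v) ⬝ᵥ ((F.U t - 1) *ᵥ v) ≤ (ℓ * t) ^ 2 * (v ⬝ᵥ v))
  {e : ℝ} (he : 0 < e) {n L : ℕ} (hn : 1 ≤ n) (hL : 1 ≤ L) {a : ℝ} (ha : 0 < a) {a' : ℝ} (ha' : 0 < a')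
  {m2 : ℝ} (hm : 0 ≤ m2) (Zc : Finset (Fin (d + 1) → ℤ)) {Ac : (Fin (d + 1) → ℤ) → Fin (d + 1) → ℝ} {c β : ℝ}
  (hc : 0 ≤ c)
  (h17 : ∀ x ∈ fineDom n (fineDom L Zc), ∀ μ ν : Fin (d + 1), |Ac (x + e1 μ) ν - Ac x ν| ≤ c * e ^ (β - 1) / n)
  (hsmall : ℓ ^ 2 * ((d + 1) * c * e ^ β) ^ 2 * (d + 1) * (1 + a * (d + 1)) ≤ min 2 a / 4)

include hℓ hLip he ha ha' hm hc h17 hsmall in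
/-- **(5.1) = (1.15), UPPER BOUND, AT A REGULAR `A ≠ 0`**: *"Δ^{(k)}(Ω,A) + aL^{−2}P(A) = a_kI −
a_k²Q_k(A)G_k(Ω,A)Q_k^*(A) + aL^{−2}P(A) ≤ a_kI + aL^{−2}Q^*(A)Q(A) ≤ (a_k + aL^{−2})I"* — for every mesh, every `L ≥ 1`,
every finite union `Ω^{(k)}` of `L`-blocks, every `m² ≥ 0` and every vector field with (1.7) on `Ω` and b04's smallness
of `e` (so that `G_k(Ω,A) > 0`): r01's `form115_upper` with `G_k(Ω,A) = regionOp⁻¹ > 0` (`regionOp_form_ge`) and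
`P(A) ≤ I` (`rowOrtho_nextAvg`). [cite: Balaban1983RegularityDecay, (1.15) p.574, (5.1) p.593] -/
theorem form115_upper_regular (ψ : ↥(fineDom L Zc) × ι → ℝ) :
    ψ ⬝ᵥ ((B4GaussRep36.deltaK (hamR F e m2 (fineDom L Zc) Ac n) a (QkR F e hn (fineDom L Zc) Ac)
        + (a' * ((L : ℝ) ^ 2)⁻¹) • pOp (((L ^ (d + 1) : ℕ) : ℝ)) (nextAvg F (e / n) hL Zc n Ac)) *ᵥ ψ)
      ≤ (a + a' * ((L : ℝ) ^ 2)⁻¹) * (ψ ⬝ᵥ ψ) := by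
  have hL0 : (((L ^ (d + 1) : ℕ) : ℝ)) ≠ 0 := by
    have : 0 < L ^ (d + 1) := pow_pos hL _
    exact_mod_cast this.ne'
  have hγ : 0 < min 2 a / 4 + m2 := add_pos_of_pos_of_nonneg (div_pos (lt_min two_pos ha) four_pos) hm
  have hK : (kForm (hamR F e m2 (fineDom L Zc) Ac n) a (QkR F e hn (fineDom L Zc) Ac)).PosDef := by
    rw [kForm_eq_regionOp]
    refine posDef_of_form_ge ?_ hγ (regionOp_form_ge F hℓ hLip he hn ha (fineDom L Zc) hc h17 hsmall)
    rw [← kForm_eq_regionOp F e hn a m2 (fineDom L Zc) Ac]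
    exact B4Prop23Sect5Route.kForm_isSymm (hamR_isSymm F e m2 (fineDom L Zc) Ac) a _
  exact B4Ineq115Sect3Route.form115_upper _ _ _ hK (by positivity)
    (fun v => dotProduct_pOp_mulVec_le (rowOrtho_nextAvg F (e / n) hL Zc n Ac) hL0 v) ψ

end Regular

/-! ## §3. (5.2)–(5.3): the lower bound of (1.15) at a regular `A ≠ 0`, explicit constant -/

/-- p35's constant `γ₀ = γ₀(a, m²) = 1/max((6(d+1)+2m²)/a, 24)` of (1.22) in lattice units (`form122_lattice`).
[cite: Balaban1983RegularityDecay, (1.22) p.574, (5.2) p.593] -/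
def gam0 (d : ℕ) (a m2 : ℝ) : ℝ := (max ((6 * (d + 1) + 2 * m2) / a) 24)⁻¹

/-- THE LOWER CONSTANT `γ₀″` OF (5.3)/(1.15) at a regular field, uniform on the mass window `m² ∈ [0, m²₊]`:
`γ₀″ = γ₀(a,m²₊)·min(2, a′/γ₀(a,m²₊))/(8L²)`. [cite: Balaban1983RegularityDecay, (5.3) p.593, (1.15) p.574] -/
def gamLow (d L : ℕ) (a a' m2max : ℝ) : ℝ :=
  gam0 d a m2max * (min 2 (a' / gam0 d a m2max) / 4) / (2 * (L : ℝ) ^ 2)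

/-- `γ₀ > 0`. [cite: Balaban1983RegularityDecay, (1.22) p.574] -/
theorem gam0_pos (d : ℕ) (a m2 : ℝ) : 0 < gam0 d a m2 :=
  inv_pos.2 (lt_of_lt_of_le (by norm_num) (le_max_right _ _))

/-- `γ₀(a, ·)` is antitone in `m²` (`a > 0`). [cite: Balaban1983RegularityDecay, (1.22) p.574] -/
theorem gam0_anti (d : ℕ) {a : ℝ} (ha : 0 < a) {m2 m2' : ℝ} (h : m2 ≤ m2') : gam0 d a m2' ≤ gam0 d a m2 := by
  unfold gam0
  have h0 : 0 < max ((6 * (d + 1) + 2 * m2) / a) 24 := lt_of_lt_of_le (by norm_num) (le_max_right _ _)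
  refine inv_anti₀ h0 (max_le_max ?_ le_rfl)
  exact div_le_div_of_nonneg_right (by linarith) ha.le

/-- `γ₀″ > 0` (`a′ > 0`, `L ≥ 1`). [cite: Balaban1983RegularityDecay, (5.3) p.593] -/
theorem gamLow_pos (d : ℕ) {L : ℕ} (hL : 1 ≤ L) (a : ℝ) {a' : ℝ} (ha' : 0 < a') (m2max : ℝ) :
    0 < gamLow d L a a' m2max := by
  have hL0 : (0 : ℝ) < L := by exact_mod_cast hL
  have hg := gam0_pos d a m2max
  unfold gamLow
  have : 0 < min 2 (a' / gam0 d a m2max) := lt_min two_pos (div_pos ha' hg)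
  positivity

/-- the covariant bond sum of (1.22)/(5.2) is non-negative. [cite: Balaban1983RegularityDecay, (1.22) p.574] -/
theorem covDiffSq_nonneg (F : OrthFlow ι) (κ : ℝ) (Ac : (Fin (d + 1) → ℤ) → Fin (d + 1) → ℝ) (n : ℕ)
    (Ωc : Finset (Fin (d + 1) → ℤ)) (ψ : ↥Ωc × ι → ℝ) : 0 ≤ covDiffSq F κ Ac n Ωc ψ := by
  unfold covDiffSq
  refine Finset.sum_nonneg fun y _ => Finset.sum_nonneg fun μ _ => ?_
  split_ifs
  · exact dotProduct_self_nonneg' _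
  · exact le_rfl

section Lower

variable (F : OrthFlow ι) {ℓ : ℝ} (hℓ : 0 ≤ ℓ)
  (hLip : ∀ t (v : ι → ℝ), ((F.U t - 1) *ᵥ v) ⬝ᵥ ((F.U t - 1) *ᵥ v) ≤ (ℓ * t) ^ 2 * (v ⬝ᵥ v))
  {e : ℝ} (he : 0 < e) {n L : ℕ} (hn : 1 ≤ n) (hL : 1 ≤ L) {a : ℝ} (ha : 0 < a) {a' : ℝ} (ha' : 0 < a')
  {m2 m2max : ℝ} (hm : 0 ≤ m2) (hmm : m2 ≤ m2max) (Zc : Finset (Fin (d + 1) → ℤ))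
  {Ac : (Fin (d + 1) → ℤ) → Fin (d + 1) → ℝ} {c β : ℝ} (hc : 0 ≤ c)
  (h17 : ∀ x ∈ fineDom n (fineDom L Zc), ∀ μ ν : Fin (d + 1), |Ac (x + e1 μ) ν - Ac x ν| ≤ c * e ^ (β - 1) / n)
  (hsmall : ℓ ^ 2 * ((d + 1) * c * e ^ β) ^ 2 * (d + 1) * (1 + a * (d + 1)) ≤ min 2 a / 4)
  (hsmallU : ℓ ^ 2 * ((d + 1) * ((L : ℝ) ^ 2 * c) * e ^ β) ^ 2 * (d + 1)
      * (1 + (a' / gam0 d a m2max) * (d + 1)) ≤ min 2 (a' / gam0 d a m2max) / 4)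
  (hX : gam0 d a m2 * (6 * (d + 1) * (a / (min 2 a / 4 + m2)) ^ 2 * (ℓ * ((3 * d + 4) * c * e ^ β)) ^ 2)
      ≤ gamLow d L a a' m2max)

include hℓ hLip he ha ha' hm hmm hc h17 hsmall hsmallU hX in
/-- **(5.2)–(5.3) = (1.15), LOWER BOUND, AT A REGULAR `A ≠ 0`, EXPLICIT CONSTANT**: for every mesh `n ≥ 1`, `L ≥ 1`,
every finite union `Ω^{(k)}` of `L`-blocks (labels `Ω^{(k+1)} = Zc`), every `m² ∈ [0, m²₊]`, every vector field with (1.7)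
`|A_ν(x+e_μ) − A_ν(x)| ≤ c·e^{β−1}/n` on `Ω`, and `e` small (`hsmall`, `hsmallU`, `hX`):
`γ₀″|φ|² ≤ ⟨φ, (Δ^{(k)}(Ω,A) + a′L^{−2}P(A))φ⟩`, `γ₀″ = gamLow`.  Route exactly as printed: (5.2) is p35's (1.22)
(`form122_lattice`, `γ₀ = γ₀(a,m²) ≥ γ₀(a,m²₊)`) plus the `P(A)` term; the block step `block_lower_regular` with `a″ =
a′/γ₀(a,m²₊)` gives `γ₀E_A(φ) + a′L^{−2}⟨φ,P(A)φ⟩ ≥ 2γ₀″|φ|²`; the printed remainder `O(e^{2−δ})|φ|²` is p35's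
`γ₀·6(d+1)(a/γ_H)²(ℓ(3d+4)c·e^β)²|φ|² ≤ γ₀″|φ|²` (`hX`). [cite: Balaban1983RegularityDecay, (1.15) p.574, (5.2)–(5.3) p.593] -/
theorem form115_lower_regular (ψ : ↥(fineDom L Zc) × ι → ℝ) :
    gamLow d L a a' m2max * (ψ ⬝ᵥ ψ)
      ≤ ψ ⬝ᵥ ((B4GaussRep36.deltaK (hamR F e m2 (fineDom L Zc) Ac n) a (QkR F e hn (fineDom L Zc) Ac)
          + (a' * ((L : ℝ) ^ 2)⁻¹) • pOp (((L ^ (d + 1) : ℕ) : ℝ)) (nextAvg F (e / n) hL Zc n Ac)) *ᵥ ψ) := by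
  have hn0 : (0 : ℝ) < n := by exact_mod_cast hn
  have hL0 : (0 : ℝ) < L := by exact_mod_cast hL
  set γ : ℝ := gam0 d a m2 with hγ_def
  set γm : ℝ := gam0 d a m2max with hγm_def
  have hγm : 0 < γm := gam0_pos d a m2max
  have hγ0 : 0 < γ := gam0_pos d a m2
  have hγge : γm ≤ γ := gam0_anti d ha hmm
  set a'' : ℝ := a' / γm with ha''_def
  have ha'' : 0 ≤ a'' := div_nonneg ha'.le hγm.le
  have hga : γm * a'' = a' := by rw [ha''_def]; field_simp
  set δ : ℝ := c * e ^ (β - 1) / n with hδ_def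
  have heβ : 0 ≤ e ^ (β - 1) := Real.rpow_nonneg he.le _
  have heβ' : 0 ≤ e ^ β := Real.rpow_nonneg he.le _
  have hδ : 0 ≤ δ := by positivity
  have hesplit : e * e ^ (β - 1) = e ^ β := by
    rw [show β = 1 + (β - 1) by ring, Real.rpow_add he, Real.rpow_one]
    ring_nf
  have hκ : |e / n| = e / n := abs_of_pos (div_pos he hn0)
  have hκθ : |e / n| * ((d + 1) * n * δ) ≤ (d + 1) * c * e ^ β / n := by
    rw [hκ, hδ_def]
    have : e / n * ((d + 1) * n * (c * e ^ (β - 1) / n)) = (d + 1) * c * (e * e ^ (β - 1)) / n := by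
      field_simp
    rw [this, hesplit]
  have h52 := form122_lattice F hℓ hLip (e / n) hn ha hm (fineDom L Zc) Ac hδ (by positivity) h17 hκθ hsmall ψ
  have h52' : γ * (covDiffSq F (e / n) Ac n (fineDom L Zc) ψ + m2 * (ψ ⬝ᵥ ψ))
      - γ * (6 * (d + 1) * (a / (min 2 a / 4 + m2)) ^ 2 * (ℓ * ((3 * d + 4) * c * e ^ β)) ^ 2) * (ψ ⬝ᵥ ψ)
        ≤ ψ ⬝ᵥ (B4GaussRep36.deltaK (hamR F e m2 (fineDom L Zc) Ac n) a (QkR F e hn (fineDom L Zc) Ac) *ᵥ ψ) := by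
    have hXeq : ℓ * (|e / n| * ((3 * d + 4) * n ^ 2 * δ)) = ℓ * ((3 * d + 4) * c * e ^ β) := by
      rw [hκ, hδ_def]
      have : e / n * ((3 * d + 4) * n ^ 2 * (c * e ^ (β - 1) / n)) = (3 * d + 4) * c * (e * e ^ (β - 1)) := by
        field_simp
      rw [this, hesplit]
    rw [hXeq] at h52
    rw [deltaK_rep36_eq]
    exact h52
  have h17' : ∀ x ∈ fineDom n (fineDom L Zc), ∀ μ ν : Fin (d + 1), |Ac (x + e1 μ) ν - Ac x ν| ≤ δ := h17
  have hsmallU' : ℓ ^ 2 * (|e / n| * ((d + 1) * n ^ 2 * L ^ 2 * δ)) ^ 2 * (d + 1) * (1 + a'' * (d + 1))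
      ≤ min 2 a'' / 4 := by
    have hθeq : |e / n| * ((d + 1) * n ^ 2 * L ^ 2 * δ) = (d + 1) * ((L : ℝ) ^ 2 * c) * e ^ β := by
      rw [hκ, hδ_def]
      have : e / n * ((d + 1) * n ^ 2 * L ^ 2 * (c * e ^ (β - 1) / n))
          = (d + 1) * ((L : ℝ) ^ 2 * c) * (e * e ^ (β - 1)) := by
        field_simp
      rw [this, hesplit]
    rw [hθeq]
    exact hsmallU
  have hblk := B4Ineq53RegularRegion.block_lower_regular F hℓ hLip (e / n) hn hL Zc Ac ha'' hδ h17' hsmallU' ψ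
  have hC : 0 ≤ covDiffSq F (e / n) Ac n (fineDom L Zc) ψ := covDiffSq_nonneg F (e / n) Ac n (fineDom L Zc) ψ
  have hS : 0 ≤ ψ ⬝ᵥ ψ := dotProduct_self_nonneg' ψ
  set C : ℝ := covDiffSq F (e / n) Ac n (fineDom L Zc) ψ
  set S : ℝ := ψ ⬝ᵥ ψ
  set Pf : ℝ := ψ ⬝ᵥ (pOp (((L ^ (d + 1) : ℕ) : ℝ)) (nextAvg F (e / n) hL Zc n Ac) *ᵥ ψ)
  set D : ℝ := ψ ⬝ᵥ (B4GaussRep36.deltaK (hamR F e m2 (fineDom L Zc) Ac n) a (QkR F e hn (fineDom L Zc) Ac) *ᵥ ψ)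
  set X : ℝ := γ * (6 * (d + 1) * (a / (min 2 a / 4 + m2)) ^ 2 * (ℓ * ((3 * d + 4) * c * e ^ β)) ^ 2)
  have e1 : γm * C ≤ γ * C := mul_le_mul_of_nonneg_right hγge hC
  have e2 : 0 ≤ γ * (m2 * S) := mul_nonneg hγ0.le (mul_nonneg hm hS)
  have e3 : ((L : ℝ) ^ 2)⁻¹ * (γm * (min 2 a'' / 4 * S))
      ≤ ((L : ℝ) ^ 2)⁻¹ * (γm * ((L : ℝ) ^ 2 * C + a'' * Pf)) :=
    mul_le_mul_of_nonneg_left (mul_le_mul_of_nonneg_left hblk hγm.le) (by positivity)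
  have e3' : ((L : ℝ) ^ 2)⁻¹ * (γm * (min 2 a'' / 4 * S)) ≤ γm * C + a' * ((L : ℝ) ^ 2)⁻¹ * Pf := by
    have hre : ((L : ℝ) ^ 2)⁻¹ * (γm * ((L : ℝ) ^ 2 * C + a'' * Pf)) = γm * C + a' * ((L : ℝ) ^ 2)⁻¹ * Pf := by
      rw [← hga]
      field_simp
    rw [hre] at e3
    exact e3
  have e5 : gamLow d L a a' m2max = γm * (min 2 a'' / 4) * ((L : ℝ) ^ 2)⁻¹ / 2 := by
    simp only [gamLow, ← hγm_def, ← ha''_def]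
    field_simp
  have h52'' : γ * (C + m2 * S) - X * S ≤ D := h52'
  rw [e5] at hX
  have e4 : X * S ≤ γm * (min 2 a'' / 4) * ((L : ℝ) ^ 2)⁻¹ / 2 * S := mul_le_mul_of_nonneg_right hX hS
  rw [Matrix.add_mulVec, dotProduct_add, Matrix.smul_mulVec, dotProduct_smul, smul_eq_mul, e5]
  show γm * (min 2 a'' / 4) * ((L : ℝ) ^ 2)⁻¹ / 2 * S ≤ D + a' * ((L : ℝ) ^ 2)⁻¹ * Pf
  linarith [h52'', e1, e2, e3', e4]

end Lower

end

end Literature.MathematicalPhysics.QuantumFieldTheory.Balaban1983to89.B4Ineq53RegularRegion
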